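import Summits.QuantumFields.YangMills.Theorems.BalabanLadderIRTemperedRecursionStep
import HarnessLib

/-!
# The tempered Dobrushin–Shlosman block recursion (IR line L2″, engine part 1/2), module 2/2

Helper module for item `stmt-QuantumFields-19354` (crux `IR` of route `BalabanLadder`; registered
line L2″ «cell-tempered», skeleton of record `IR_birth_cell_v7.lean`; engine stub
`Cruxes.IR.CellTempered.stub_temperedToTV`).  Route owner ym-beyond-p2 (g17), filed by the cell's
courier.

* `tempered_recursion_decay` — iterating `tempered_recursion_step` (module 1/2,
  `Theorems.BalabanLadderIRTemperedRecursionStep`) from the trivial bound `1`: influence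
  `≤ (εM)^j + 4Mδ'·Σ_{i<j} (εM)^i` at agreement radius `j(2n+1)`.

## Filing note (courier g7, 2026-08-26)

Module 2/2 of the route owner's file `HOME/p2-g17-files/IRTemperedRecursion.lean` (sha16
`e78b5862595cea05`, 423 lines): source lines 361–423 verbatim behind the re-opened preamble (source
lines 44–53); module 1/2 carries source lines 1–359 and the full module docstring with references.
Split only because the gate caps Theorems files with proofs at 400 lines; same namespace, bodies
byte-identical, no statement changed, no mathematics added.
-/

noncomputable section

open MeasureTheory
open Literature.Probability.LatticeModels
open Literature.MathematicalPhysics.QuantumLattice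
open Summit.QuantumFields.YangMills.Theorems.FiniteSizeCriterion

namespace Summit.QuantumFields.YangMills.Cruxes.IR.CellTempered.Engine

variable {d : ℕ} {S : Type*} [MeasurableSpace S]

/-- **Tempered exponential-plus-floor decay** by the tree's induction on `j`: influence
`≤ (εM)^j + 4Mδ'·Σ_{i<j}(εM)^i` at agreement radius `j(2n+1)`. -/
theorem tempered_recursion_decay {γ : Specification (ZdEdge d) S} (hγ : IsSpecification γ)
    (hloc : ∀ (Λ : Finset (ZdEdge d)) (f : (ZdEdge d → S) → ℝ) (T : Finset (ZdEdge d)),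
      Measurable f → DependsOn f ↑T →
        DependsOn (fun η => ∫ σ, f σ ∂(γ Λ η)) ↑(T ∪ (plaquettesTouching Λ).biUnion plaquetteEdges))
    {cell : ZdEdge d → (Fin d → ℤ)}
    (hC1 : ∀ e e' : ZdEdge d, (∀ k, e'.1 k - 1 ≤ e.1 k ∧ e.1 k ≤ e'.1 k + 1) →
      ∀ k, |cell e k - cell e' k| ≤ 1)
    (hfin : ∀ y : Fin d → ℤ, Set.Finite {v : ZdEdge d | cell v = y})
    {n : ℕ} {ε : ℝ} (hε : 0 ≤ ε) (hε1 : ε ≤ 1)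
    (Good : (Fin d → ℤ) → (Fin d → ℤ) → Set (ZdEdge d → S))
    (hGm : ∀ x c, MeasurableSet (Good x c))
    {δ' : ℝ} (hδ' : 0 ≤ δ')
    (hBad : ∀ (x c : Fin d → ℤ) (E : Finset (ZdEdge d)), (∀ v, cell v = c → v ∈ E) →
      ∀ ζ : ZdEdge d → S, (γ E ζ) (Good x c)ᶜ ≤ ENNReal.ofReal δ')
    (hFS : ∀ (x : Fin d → ℤ) (Λ₀ : Finset (ZdEdge d)),
      (∀ v w, cell v = cell w → v ∈ Λ₀ → w ∈ Λ₀) →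
      (∀ v ∈ Λ₀, ∀ i, |cell v i - x i| ≤ 2 * n) → (∀ v, cell v = x → v ∈ Λ₀) →
      ∀ η η' : ZdEdge d → S,
        (∀ v, v ∉ Λ₀ → (∀ i, |cell v i - x i| ≤ 2 * n + 1) →
          (η v = η' v ∨ (η ∈ Good x (cell v) ∧ η' ∈ Good x (cell v)))) →
      ∀ f : (ZdEdge d → S) → ℝ, DependsOn f {v | cell v = x} → Measurable f →
        (∀ σ, 0 ≤ f σ ∧ f σ ≤ 1) → |∫ σ, f σ ∂(γ Λ₀ η) - ∫ σ, f σ ∂(γ Λ₀ η')| ≤ ε)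
    (j : ℕ) (Λ : Finset (ZdEdge d)) (hΛ : ∀ v w, cell v = cell w → v ∈ Λ → w ∈ Λ)
    (x : Fin d → ℤ) (g : (ZdEdge d → S) → ℝ) (hgm : Measurable g) (hg01 : ∀ σ, 0 ≤ g σ ∧ g σ ≤ 1)
    (hgdep : DependsOn g {v | cell v = x}) (ζ ζ' : ZdEdge d → S)
    (hagree : ∀ v, v ∉ Λ → (∀ i, |cell v i - x i| ≤ j * (2 * n + 1)) → ζ v = ζ' v) :
    |∫ σ, g σ ∂(γ Λ ζ) - ∫ σ, g σ ∂(γ Λ ζ')| ≤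
      (ε * (((2 * (2 * n + 1) + 1) ^ d - (2 * (2 * n) + 1) ^ d : ℕ) : ℝ)) ^ j +
        4 * (((2 * (2 * n + 1) + 1) ^ d - (2 * (2 * n) + 1) ^ d : ℕ) : ℝ) * δ' *
          ∑ i ∈ Finset.range j,
            (ε * (((2 * (2 * n + 1) + 1) ^ d - (2 * (2 * n) + 1) ^ d : ℕ) : ℝ)) ^ i := by
  set M : ℝ := (((2 * (2 * n + 1) + 1) ^ d - (2 * (2 * n) + 1) ^ d : ℕ) : ℝ) with hM
  induction j generalizing Λ x g ζ ζ' with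
  | zero =>
    haveI := hγ.isProbability Λ ζ
    haveI := hγ.isProbability Λ ζ'
    rw [pow_zero, Finset.sum_range_zero, mul_zero, add_zero]
    have h1 := integral_mem_unitInterval (μ := γ Λ ζ) hgm hg01
    have h2 := integral_mem_unitInterval (μ := γ Λ ζ') hgm hg01
    rw [abs_le]
    constructor <;> linarith [h1.1, h1.2, h2.1, h2.2]
  | succ j ih =>
    have h := tempered_recursion_step hγ hloc hC1 hfin hε hε1 Good hGm hδ' hBad hFS (j := j)
      (δ := (ε * M) ^ j + 4 * M * δ' * ∑ i ∈ Finset.range j, (ε * M) ^ i)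
      ih Λ hΛ x g hgm hg01 hgdep ζ ζ' (fun v hv hd => hagree v hv fun i => by
        have := hd i; push_cast; linarith)
    calc |∫ σ, g σ ∂(γ Λ ζ) - ∫ σ, g σ ∂(γ Λ ζ')|
        ≤ ε * M * ((ε * M) ^ j + 4 * M * δ' * ∑ i ∈ Finset.range j, (ε * M) ^ i) +
            4 * M * δ' := h
      _ = (ε * M) ^ (j + 1) + 4 * M * δ' * ∑ i ∈ Finset.range (j + 1), (ε * M) ^ i := by
          have hs : ∑ i ∈ Finset.range (j + 1), (ε * M) ^ i
              = (ε * M) * ∑ i ∈ Finset.range j, (ε * M) ^ i + 1 := by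
            rw [Finset.sum_range_succ', pow_zero, Finset.mul_sum]
            congr 1
            exact Finset.sum_congr rfl fun i _ => by ring
          rw [hs]
          ring

end Summit.QuantumFields.YangMills.Cruxes.IR.CellTempered.Engine

end
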